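import Mathlib
import HarnessLib
import Summits.Langlands.Langlands.Theses.SkinnerWilesDefectOne
import Literature.NumberTheory.GaloisRepresentations.NearlyOrdinaryDeformationRing

/-!
# Route `SkinnerWilesDefectOne`, crux `ReducibleOrdinaryProModular` (stmt-Langlands-12919): vocabulary of
# the line `steinberg-hyperplane`

Route-posited objects (D-0016 `<Route><Crux>Defs`-type file, same convention as
`PhantomRMYoshidaResiduallyYoshidaLiftingDefs.lean`) shared by the six registered stubs of the checked
skeleton `Cruxes/ReducibleOrdinaryProModular/Lines/steinberg_hyperplane.lean` (lead copy registered
2026-08-16 by `ledger skeleton check`, stubs `stub_chebotarevSupply`, `stub_orientedSteinbergDatum`,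
`stub_smallReducibleSteinbergLocus`, `stub_steinbergLevelEngine`, `stub_iharaCrossing`,
`stub_largeSelmerRegime`) and by the crux file that will compose them.  NOTHING IS ASSERTED: every
`def … : Prop` / `structure … : Prop` below is a *statement* consumed only as (part of) the type of a stub
theorem or of the crux; the two `Type`-valued declarations (`ModelData`, bundling a coefficient DVR, a
residual datum, a universal nearly ordinary deformation ring of the tree's interface
`NearlyOrdinaryDeformationRing` and a specialisation; `fracModPrime`/`steinbergLocus`/`baseLevel`/
`chebotarevWindow`, plain data) bundle EXISTING tree vocabulary and introduce no axiom.  Declared in the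
skeleton's namespace `Summit.Langlands.Langlands.Cruxes.ReducibleOrdinaryProModular.SteinbergHyperplane`, so
that a landed stub `theorem stub_<name> : <registered signature>` reads byte-identically to its
registration (the skeleton is reshaped to import this file in place of its inline copies).

Objects (all verbatim from the planner's checked skeleton, planner-cruxplan-stmt-Langlands-12919-
steinberg-hyperplane-0, 2026-08-16; docstrings carry the mathematics):

* §1 the crux cut: `OrdLoc` (the crux's local clause at `p`, verbatim), `ProMod` (its conclusion,
  verbatim), `crux_iff : ReducibleOrdinaryProModular ↔ … := Iff.rfl`;
* §2 the Taylor–Steinberg window: `ResTrivial`, `CycloTrivialModP`, `chebotarevWindow`, `IsThin`,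
  `TaylorSteinbergPlace`, `FrobAvoids`;
* §3 deformation side: `IsSteinbergShapedAt`, `fracModPrime`, `steinbergLocus`, `IsProModularPrimeAt`,
  `SteinbergPrimesProModular`, `SmallReducibleSteinbergLocus`, `HasFiniteOrderRatio`,
  `ClosedPointStratumLE`, `ModelData` (+ `Models`), `baseLevel`, `UniqueAdmissibleExtension`;
* §0 the lever's two kernel-checked identities `tame_relation_pin`, `steinberg_hyperplane` (entries form of
  "a reducible Steinberg-shaped point lies on `Ψ(Frob_{v₀}) = q_{v₀}`"), used by the heart stub's proof.

References: SkinnerWiles1999 §§2.1–2.3, 4.1; CalegariMazur2008 §2; arXiv:1812.09999 §6.2.5 (Taylor–Steinberg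
window); the line card `Cruxes/ReducibleOrdinaryProModular/Lines/steinberg-hyperplane.md`.
-/

namespace Summit.Langlands.Langlands.Cruxes.ReducibleOrdinaryProModular.SteinbergHyperplane

-- `Summit.Langlands.Langlands.…` (summit = sub-problem name, D-0017 layout) trips `dupNamespace` on every decl.
set_option linter.dupNamespace false
set_option autoImplicit false

open scoped NumberField MatrixGroups
open Filter NumberField IsDedekindDomain Field Polynomial Matrix
open Literature.NumberTheory.Automorphic Literature.NumberTheory.Automorphic.BigHeckeGLn
open Literature.NumberTheory.GaloisRepresentations
open Summit.Langlands.Langlands.Theses.SkinnerWilesDefectOne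

noncomputable section

/-! ## 0. The lever in two lines (entries form) -/

/-- **Tame relation pin.** `Φ = (a b; 0 d)` (Frobenius) and `N = (1 x; 0 1)` (a generator of tame inertia)
with `Φ N Φ⁻¹ = N^q`, written on the `(0,1)` entry as `a x + b = b + q x d`, force `(a − q d) x = 0`:
a reducible, inertially-unipotent pair is either unramified (`x = 0`) or lies on the hyperplane
`Ψ(Frob) = a/d = q`. [folklore] -/
theorem tame_relation_pin {A : Type*} [CommRing A] (a b d x : A) (q : ℕ)
    (hrel : a * x + b = b + (q : A) * x * d) : (a - (q : A) * d) * x = 0 := by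
  have h : a * x = (q : A) * x * d := by linear_combination hrel
  linear_combination h

/-- **The Steinberg hyperplane.** Over a domain a genuinely ramified (`x ≠ 0`) reducible point satisfies
`a = q d`, i.e. `Ψ(Frob_{v₀}) = q_{v₀}` — the codimension-one condition the whole line exploits. [folklore] -/
theorem steinberg_hyperplane {A : Type*} [CommRing A] [IsDomain A] (a b d x : A) (q : ℕ)
    (hrel : a * x + b = b + (q : A) * x * d) (hx : x ≠ 0) : a = (q : A) * d := by
  rcases mul_eq_zero.mp (tame_relation_pin a b d x q hrel) with h0 | h0
  · exact sub_eq_zero.mp h0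
  · exact absurd h0 hx

/-! ## 1. Vocabulary I: the crux cut into hypotheses / conclusion (verbatim) -/

section Crux

variable {F : Type} [Field F] [NumberField F] (p : ℕ) [Fact p.Prime]

/-- H_loc of the crux, verbatim: ONE parallel weight `k ≥ 2`, exponent `m > 0`, and at every `v ∣ p`
`p`-distinguishedness of `ρ₀` plus an ORIENTED ordinary frame `Q` (`‖Q₀₀‖ ≤ ‖Q₁₀‖`: the ordinary line is
residually transverse to the global sub-line `e₀`, Disproof §5). [folklore] -/
def OrdLoc (O : ValuationSubring (PadicAlgCl p)) (ρ : FramedGaloisRep F (PadicAlgCl p) 2)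
    (ρ₀ : absoluteGaloisGroup F →* GL (Fin 2) O) : Prop :=
  ∃ k : ℕ, 2 ≤ k ∧ ∃ m : ℕ, 0 < m ∧
    ∀ v : HeightOneSpectrum (𝓞 F), (p : 𝓞 F) ∈ v.asIdeal →
      IsPDistinguishedAt ρ₀ v ∧
      ∃ Q : Matrix.GeneralLinearGroup (Fin 2) (PadicAlgCl p),
        Valued.v (Q.val 0 0) ≤ Valued.v (Q.val 1 0) ∧
        ∀ σ, (Q⁻¹ * ρ.toLocal v σ * Q).val 1 0 = 0 ∧
          (σ ∈ absInertia (v.adicCompletion F) →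
            (Q⁻¹ * ρ.toLocal v σ * Q).val 1 1 ^ m = 1 ∧
            (Q⁻¹ * ρ.toLocal v σ * Q).val 0 0 ^ m =
              algebraMap (Padic p) (PadicAlgCl p)
                (((GaloisRep.cyclotomicCharacter (v.adicCompletion F) p σ).val : PadicInt p) :
                  Padic p) ^ ((k - 1) * m))

/-- The crux's conclusion, verbatim: `ρ` is `p`-adically automorphic of SOME tame level. [folklore] -/
def ProMod (ρ : FramedGaloisRep F (PadicAlgCl p) 2) : Prop :=
  ∃ 𝒰 : TameLevel 2 F p, 𝒰.IsPadicallyAutomorphic ρ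

/-- The crux re-read through `OrdLoc`/`ProMod`: definitional (`Iff.rfl`). [folklore] -/
theorem crux_iff :
    ReducibleOrdinaryProModular ↔
      ∀ (F : Type) [Field F] [NumberField F], IsTotallyComplex F → Module.finrank ℚ F = 2 →
        ∀ (p : ℕ) [Fact p.Prime], p ≠ 2 →
        ∀ (O : ValuationSubring (PadicAlgCl p)),
          O = (Valued.v : Valuation (PadicAlgCl p) NNReal).valuationSubring →
        ∀ (ρ : FramedGaloisRep F (PadicAlgCl p) 2)
          (ρ₀ : absoluteGaloisGroup F →* GL (Fin 2) O),
          ρ.toGaloisRep.IsIrreducible → (∀ᶠ v in cofinite, ρ.IsUnramifiedAt v) →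
          ρ.HasUpperTriangularIntegralModel ρ₀ → OrdLoc p O ρ ρ₀ → ProMod p ρ :=
  Iff.rfl

/-! ## 2. Vocabulary II: the Taylor–Steinberg window for `v₀` and thin Frobenius conditions -/

/-- `τ ∈ Γ_F` is **residually trivial** for the integral model `ρ₀`: `ρ₀(τ) ≡ 1 (mod 𝔪_O)` entrywise
(so `τ` fixes the splitting field of `ρ̄ = ρ₀ mod 𝔪`, cocycle included). [folklore] -/
def ResTrivial {O : ValuationSubring (PadicAlgCl p)} (ρ₀ : absoluteGaloisGroup F →* GL (Fin 2) O)
    (τ : absoluteGaloisGroup F) : Prop :=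
  ∀ i j : Fin 2, ((ρ₀ τ).val i j - (1 : Matrix (Fin 2) (Fin 2) O) i j) ∈ IsLocalRing.maximalIdeal O

/-- `τ` acts trivially on `μ_p`: the `p`-adic cyclotomic character of `τ` is `≡ 1 (mod p)`
(for an arithmetic Frobenius at `v₀ ∤ p` this is `N v₀ ≡ 1 (mod p)`). [folklore] -/
def CycloTrivialModP (τ : absoluteGaloisGroup F) : Prop :=
  ((GaloisRep.cyclotomicCharacter F p τ : ℤ_[p]ˣ) : ℤ_[p]) - 1 ∈ IsLocalRing.maximalIdeal ℤ_[p]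

/-- The **Čebotarev window** `G₀ = Gal(F̄ / F(ρ̄, μ_p))` as a set: residually trivial and trivial on `μ_p`. [folklore] -/
def chebotarevWindow {O : ValuationSubring (PadicAlgCl p)}
    (ρ₀ : absoluteGaloisGroup F →* GL (Fin 2) O) : Set (absoluteGaloisGroup F) :=
  {τ | ResTrivial p ρ₀ τ ∧ CycloTrivialModP p τ}

/-- A **thin** set of Frobenius conditions (what Čebotarev can avoid): `B ⊆ Γ_F` is a union of cosets of an
open normal subgroup `N ≤ G₀` (`G₀` = the Čebotarev window, GIVEN as a subgroup — so the prover of a thinness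
claim, not this definition, shows the window is a group), stable under conjugation, and misses a WHOLE coset `τN`
of the window.  The card's avoidance conditions (direction of `Frob_{v₀}` in `Gal(F̃_∞/F)/pⁿ` off finitely many
lines: `s·pⁿ` of `p^{2n}` classes; non-splitting in the `ℤ/p`-layers `M₁^{±}/F(ψ₀^{±})` cut out by the generic
classes `κ_{Ψ₁^{±}}`: `1/p` each) live in fields linearly disjoint over `F(ρ̄, μ_p)` (no abelian `p`-extension of
`F` inside `F(ρ̄)`: `Ψ̄ ≠ 1` acts on the cocycle), so their union is thin for every odd `p`. [folklore] -/
def IsThin {O : ValuationSubring (PadicAlgCl p)} (ρ₀ : absoluteGaloisGroup F →* GL (Fin 2) O)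
    (B : Set (absoluteGaloisGroup F)) : Prop :=
  ∃ G₀ N : Subgroup (absoluteGaloisGroup F),
    (G₀ : Set (absoluteGaloisGroup F)) = chebotarevWindow p ρ₀ ∧ N.Normal ∧
    IsOpen (N : Set (absoluteGaloisGroup F)) ∧ N ≤ G₀ ∧
    (∀ σ ∈ B, ∀ n ∈ N, σ * n ∈ B) ∧
    (∀ g σ : absoluteGaloisGroup F, σ ∈ B → g * σ * g⁻¹ ∈ B) ∧
    ∃ τ ∈ G₀, ∀ n ∈ N, τ * n ∉ B

/-- **`v₀` is a Taylor–Steinberg place for `(ρ, ρ₀)`**: `v₀ ∤ p`, `ρ` unramified at `v₀`,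
`N v₀ ≡ 1 (mod p)` and `ρ̄(Frob_{v₀}) = 1` (every arithmetic Frobenius at `v₀` is residually trivial).  Then
`v₀` is residually level-raising for both orderings (`χ̄_a(Frob) = χ̄_b(Frob)·N v₀^{±1}`, eigenvalues `1, 1`,
`q ≡ 1`), the local lifting ring at `v₀` is Taylor's `(1,1)`-unipotent ring with its two components
(unramified ∪ Steinberg) and its irreducible `(χ₁,χ₂)`-twins, and the aligned Steinberg orientation costs at most
ONE new residual split class (triage (C3)). [folklore] -/
structure TaylorSteinbergPlace {O : ValuationSubring (PadicAlgCl p)} (ρ : FramedGaloisRep F (PadicAlgCl p) 2)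
    (ρ₀ : absoluteGaloisGroup F →* GL (Fin 2) O) (v₀ : HeightOneSpectrum (𝓞 F)) : Prop where
  not_mem : (p : 𝓞 F) ∉ v₀.asIdeal
  isUnramifiedAt : ρ.IsUnramifiedAt v₀
  absNorm_modEq : Ideal.absNorm v₀.asIdeal ≡ 1 [MOD p]
  frob_resTrivial : ∀ 𝔓 ∈ v₀.primesAbove, ∀ σ : absoluteGaloisGroup F,
    IsArithFrobAt (𝓞 F) σ 𝔓 → ResTrivial p ρ₀ σ

/-- **The Frobenii at `v₀` avoid `B`** (all arithmetic Frobenii at all primes above `v₀`). [folklore] -/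
def FrobAvoids (B : Set (absoluteGaloisGroup F)) (v₀ : HeightOneSpectrum (𝓞 F)) : Prop :=
  ∀ 𝔓 ∈ v₀.primesAbove, ∀ σ : absoluteGaloisGroup F, IsArithFrobAt (𝓞 F) σ 𝔓 → σ ∉ B

end Crux

/-! ## 3. Vocabulary III: deformation side — Steinberg-shaped primes, pro-modular primes, models -/

section Deformation

variable {F : Type} [Field F] [NumberField F] {p : ℕ} [Fact p.Prime]
variable {𝒪 : Type} [CommRing 𝒪] {k : Type} [Field k] [Algebra 𝒪 k] {𝒟 : NearlyOrdinaryDatum F p 𝒪 k}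

/-- `ρ_A : Γ_F → GL₂(A)` is **Steinberg-shaped at `w`** (global form, no cyclotomic character needed): at every
prime `𝔓 ∣ w` of `ℤ̄_F` there is a frame `P` in which the decomposition group is upper triangular, inertia is
unipotent (diagonal entries `1`) and every arithmetic Frobenius `σ` has `(sub entry) = N w · (quotient entry)` —
i.e. `ρ_A|_{G_w} ~ (γ ε ∗; 0 γ)` with `γ` unramified: an unramified twist of Steinberg OR its level-raising
degeneration (unramified, eigenvalue ratio `N w`).  Over a field this is membership in the Steinberg component of
the unipotent lifting ring; on REDUCIBLE points it is the hyperplane `Ψ(Frob_w) = N w` (`steinberg_hyperplane`). [folklore] -/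
def IsSteinbergShapedAt {A : Type*} [CommRing A] (w : HeightOneSpectrum (𝓞 F))
    (ρA : absoluteGaloisGroup F →* GL (Fin 2) A) : Prop :=
  ∀ 𝔓 ∈ w.primesAbove, ∃ P : GL (Fin 2) A,
    (∀ σ ∈ 𝔓.decompositionSubgroup (absoluteGaloisGroup F), (P⁻¹ * ρA σ * P).val 1 0 = 0) ∧
    (∀ σ ∈ 𝔓.inertia (absoluteGaloisGroup F),
      (P⁻¹ * ρA σ * P).val 0 0 = 1 ∧ (P⁻¹ * ρA σ * P).val 1 1 = 1) ∧
    (∀ σ : absoluteGaloisGroup F, IsArithFrobAt (𝓞 F) σ 𝔓 →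
      (P⁻¹ * ρA σ * P).val 0 0 = (Ideal.absNorm w.asIdeal : A) * (P⁻¹ * ρA σ * P).val 1 1)

variable (𝓡 : NearlyOrdinaryDeformationRing.{0} 𝒟)

/-- `ρ_𝒟 mod 𝔮` over the field of fractions of the domain `R/𝔮` (as in the tree's `reducibleLocus`). [folklore] -/
def fracModPrime (𝔮 : PrimeSpectrum 𝓡.R) :
    absoluteGaloisGroup F →* GL (Fin 2) (FractionRing (𝓡.R ⧸ 𝔮.asIdeal)) :=
  (Matrix.GeneralLinearGroup.map
    (algebraMap (𝓡.R ⧸ 𝔮.asIdeal) (FractionRing (𝓡.R ⧸ 𝔮.asIdeal)))).comp (𝓡.modPrime 𝔮)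

/-- The **Steinberg locus at `w`** of `Spec R_𝒟`: primes `𝔮` with `ρ_𝒟 mod 𝔮` Steinberg-shaped at `w` over
`Frac(R/𝔮)` — for `w = v₀ ∈ S` the Steinberg component of the `v₀`-unipotent problem together with its
level-raising boundary; typed exactly like `NearlyOrdinaryDeformationRing.reducibleLocus`. [folklore] -/
def steinbergLocus (w : HeightOneSpectrum (𝓞 F)) : Set (PrimeSpectrum 𝓡.R) :=
  {𝔮 | IsSteinbergShapedAt w (fracModPrime 𝓡 𝔮)}

/-- **`𝔮` is a pro-modular prime of `R_𝒟` at tame level `𝒰`** (Skinner–Wiles §4.1 (4.1) with the tree's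
completed-cohomology Hecke algebra): a CONTINUOUS (for the `𝔪_R`-adic topology on `R/𝔮`) point
`x : 𝕋(𝒰) → R/𝔮` with which `ρ_𝒟 mod 𝔮` is associated off `𝒰.bad` (unramified, and
`charpoly (ρ_𝒟 mod 𝔮)(Frob_v) = heckeFrobPoly 2 q_v (x ∘ T_{v,·})`, arithmetic Frobenius) — the prime-level
form of `TameLevel.IsPadicallyAutomorphic` (cf. the landed `isPadicallyAutomorphic_iff`). [folklore] -/
def IsProModularPrimeAt (𝒰 : TameLevel 2 F p) (𝔮 : PrimeSpectrum 𝓡.R) : Prop :=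
  ∃ x : CompletedCohomologyHeckeAlgebraGLn 𝒰 →+* 𝓡.R ⧸ 𝔮.asIdeal,
    @Continuous _ _ inferInstance
      ((IsLocalRing.maximalIdeal 𝓡.R).map (Ideal.Quotient.mk 𝔮.asIdeal)).adicTopology (⇑x) ∧
    ∀ v ∉ 𝒰.bad, Deformation.IsUnramifiedAt v (𝓡.modPrime 𝔮) ∧
      ∀ 𝔓 ∈ v.primesAbove, ∀ σ : absoluteGaloisGroup F, IsArithFrobAt (𝓞 F) σ 𝔓 →
        (𝓡.modPrime 𝔮 σ).val.charpoly =
          heckeFrobPoly 2 (Ideal.absNorm v.asIdeal) (fun i => x (𝒰.heckeT v i))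

/-- **The transfer `C⁺` at prime level: every IRREDUCIBLE Steinberg-shaped prime of `R_𝒟` is pro-modular of
some tame level** (necessarily with `w ∈ bad`; reducible primes are excluded — they are Eisenstein and play no
role in the chain). [folklore] -/
def SteinbergPrimesProModular (w : HeightOneSpectrum (𝓞 F)) : Prop :=
  ∀ 𝔮 ∈ steinbergLocus 𝓡 w, 𝔮 ∉ 𝓡.reducibleLocus → ∃ 𝒰 : TameLevel 2 F p, IsProModularPrimeAt 𝓡 𝒰 𝔮

/-- **Small reducible Steinberg locus**: every reducible AND Steinberg-shaped prime `𝔮` has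
`dim R/𝔮 ≤ 3` (`< 4 = dim Λ_F − l₀`, the dimension of the nice components). [folklore] -/
def SmallReducibleSteinbergLocus (w : HeightOneSpectrum (𝓞 F)) : Prop :=
  ∀ 𝔮 ∈ 𝓡.reducibleLocus ∩ steinbergLocus 𝓡 w, ringKrullDim (𝓡.R ⧸ 𝔮.asIdeal) ≤ 3

/-- The ratio `Ψ = χ_a/χ_b` of the diagonal characters of `ρ_𝒟 mod 𝔮` has FINITE ORDER in every
upper-triangular frame over `Frac(R/𝔮)` (for reducible `𝔮`: `Ψ` is the Teichmüller constant `Ψ̄`, i.e. `𝔮`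
lies on the CLOSED-POINT STRATUM of `Spec Λ_Ψ`; vacuous for irreducible `𝔮`). [folklore] -/
def HasFiniteOrderRatio (𝔮 : PrimeSpectrum 𝓡.R) : Prop :=
  ∀ (P : GL (Fin 2) (FractionRing (𝓡.R ⧸ 𝔮.asIdeal)))
    (hP : ∀ γ, (((MulAut.conj P⁻¹).toMonoidHom.comp (fracModPrime 𝓡 𝔮)) γ).val 1 0 = 0),
    IsOfFinOrder (Deformation.diagChar _ hP 0 / Deformation.diagChar _ hP 1)

/-- **The closed-point stratum of the reducible locus has dimension `≤ d`**: every reducible prime of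
characteristic `p` with constant (finite-order) ratio `Ψ` has `dim R/𝔮 ≤ d`.  By SW99 Lemma 2.7 transposed
(triage (C5)) this stratum is `Spf k⟦T₁,T₂⟧ × ℙ(H¹_split(F_S, k(Ψ̄)))` of dimension `m_S + 1`, `m_S` the residual
split (= SW-admissible) Selmer dimension at the datum's level `S`; so `ClosedPointStratumLE 𝓡 2` at the base level
`S♯ = {v∣p} ∪ ram(ρ)` reads `m_{S♯} = 1` (the admissible residual extension is UNIQUE — Berger–Klosin-type residual
rigidity; checked for the route's 11a-witness over `ℚ(√−2)`: triage r1-3 §N, kit j009536, `r_S = 1`), and at the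
augmented level `S' = S♯ ∪ {v₀}` one has `m_{S'} ≤ m_{S♯} + 1` (one aligned Kummer class at most, triage (C3)).
NO Steinberg pin lowers this stratum; it is the regime hypothesis of the line (`UniqueAdmissibleExtension`). [folklore] -/
def ClosedPointStratumLE (d : WithBot ℕ∞) : Prop :=
  ∀ 𝔮 ∈ 𝓡.reducibleLocus, CharP (𝓡.R ⧸ 𝔮.asIdeal) p → HasFiniteOrderRatio 𝓡 𝔮 →
    ringKrullDim (𝓡.R ⧸ 𝔮.asIdeal) ≤ d

/-- **Modelling data**: a coefficient DVR `𝒪` of characteristic `0`, complete, with finite residue field `k`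
of characteristic `p` (intended `𝒪 = 𝒪_E`, `E/ℚ_p` finite), a residual datum `𝒟` over `(𝒪, k)`, a universal
nearly ordinary deformation ring `𝓡` of `𝒟` (the tree's interface) and a specialisation `φ : R → ℚ̄_p`. [folklore] -/
structure ModelData (F : Type) [Field F] [NumberField F] (p : ℕ) [Fact p.Prime] : Type 1 where
  /-- coefficient ring [folklore] -/
  𝒪 : Type
  [instCommRing : CommRing 𝒪]
  [instIsDomain : IsDomain 𝒪]
  [instDVR : IsDiscreteValuationRing 𝒪]
  [instCharZero : CharZero 𝒪]
  [instComplete : IsAdicComplete (IsLocalRing.maximalIdeal 𝒪) 𝒪]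
  /-- residue field [folklore] -/
  k : Type
  [instField : Field k]
  [instFinite : Finite k]
  [instCharP : CharP k p]
  [instAlgebra : Algebra 𝒪 k]
  /-- residual datum [folklore] -/
  𝒟 : NearlyOrdinaryDatum F p 𝒪 k
  /-- a universal nearly ordinary deformation ring of `𝒟` [folklore] -/
  𝓡 : NearlyOrdinaryDeformationRing.{0} 𝒟
  /-- the specialisation classifying (a lattice of) `ρ` [folklore] -/
  φ : 𝓡.R →+* PadicAlgCl p

attribute [instance] ModelData.instCommRing ModelData.instIsDomain ModelData.instDVR
  ModelData.instCharZero ModelData.instComplete ModelData.instField ModelData.instFinite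
  ModelData.instCharP ModelData.instAlgebra

/-- The **base level** `S♯ = {v ∣ p} ∪ ram(ρ)` of `ρ` (finite by `hunr`); the line works at `S' = S♯ ∪ {v₀}`. [folklore] -/
def baseLevel (ρ : FramedGaloisRep F (PadicAlgCl p) 2) : Set (HeightOneSpectrum (𝓞 F)) :=
  {v | (p : 𝓞 F) ∈ v.asIdeal} ∪ {v | ¬ ρ.IsUnramifiedAt v}

/-- **`M` models `(ρ, ρ₀)` at level `S`** (Skinner–Wiles' admissible ORIENTED datum; used with `S = S♯` for the
regime and `S = S♯ ∪ {v₀}` for the line): `ρ̄_𝒟` is upper triangular in the standard basis with the SAME ORDERED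
residual diagonal as `ρ₀` (global sub `= χ̄_a`), non-split with scalar centralizer (Mazur / BergerKlosin2012
Lemma 28), `p`-distinguished, SW-ORIENTED (the residual special line `(frame v) e₀` is not the global sub-line
`e₀`, i.e. `(frame v)₁₀ ≠ 0` — the residual shadow of `‖Q₀₀‖ ≤ ‖Q₁₀‖`, Disproof §5), `𝒟.S = S`, and
`φ ∘ ρ_𝒟` is a conjugate of `ρ` (so `ker φ = 𝔭_ρ ∈ Spec R` and `ρ` lies on a component `C_ρ`). [folklore] -/
structure ModelData.Models (M : ModelData F p) {O : ValuationSubring (PadicAlgCl p)}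
    (ρ : FramedGaloisRep F (PadicAlgCl p) 2) (ρ₀ : absoluteGaloisGroup F →* GL (Fin 2) O)
    (S : Set (HeightOneSpectrum (𝓞 F))) : Prop where
  residual_upper : ∀ g, (M.𝒟.residual g).val 1 0 = 0
  residual_diag : ∃ ι : M.k →+* IsLocalRing.ResidueField O,
    ∀ g (i : Fin 2), ι ((M.𝒟.residual g).val i i) = IsLocalRing.residue O ((ρ₀ g).val i i)
  hasScalarCentralizer : M.𝒟.HasScalarCentralizer
  isDistinguishedAt : ∀ v : HeightOneSpectrum (𝓞 F), (p : 𝓞 F) ∈ v.asIdeal → M.𝒟.IsDistinguishedAt v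
  oriented : ∀ v : HeightOneSpectrum (𝓞 F), (p : 𝓞 F) ∈ v.asIdeal → (M.𝒟.frame v).val 1 0 ≠ 0
  S_eq : M.𝒟.S = S
  realizes : ∃ P : GL (Fin 2) (PadicAlgCl p),
    ∀ g, Matrix.GeneralLinearGroup.map M.φ (M.𝓡.ρ g) = P⁻¹ * ρ g * P

/-- **The regime of the line: the admissible residual extension is UNIQUE at the base level** (`m_{S♯} = 1`):
every oriented model at level `S♯` has closed-point stratum of dimension `≤ 2`.  Then at every Steinberg-augmented
level `S♯ ∪ {v₀}` the closed-point stratum has dimension `≤ 3` (triage (C3): `m_{S'} ≤ m_{S♯} + 1`), which is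
all the chain needs.  Its complement (`m_{S♯} ≥ 2`) is registered as `stub_largeSelmerRegime`. [folklore] -/
def UniqueAdmissibleExtension {O : ValuationSubring (PadicAlgCl p)} (ρ : FramedGaloisRep F (PadicAlgCl p) 2)
    (ρ₀ : absoluteGaloisGroup F →* GL (Fin 2) O) : Prop :=
  ∀ M : ModelData F p, M.Models ρ ρ₀ (baseLevel ρ) → ClosedPointStratumLE M.𝓡 2

end Deformation



/-! ## 4. Reshape v2 (lead, 2026-08-16, after wave 1): aligned places and local points

Wave 1 of the line found the heart stub `stub_smallReducibleSteinbergLocus` FALSE as first registered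
(stub-worker audit, kernel-checked vocabulary, paper argument in the lead's evidence file
`line-steinberg-hyperplane-S3-misstated.md`): at a Taylor–Steinberg place `v₀` one has
`Ψ̄(Frob_{v₀}) = 1 = ω(Frob_{v₀})`, so the lift `Ψ⁺ := ν̃·ε` (`ν := Ψ̄ω⁻¹`, `ν̃` its Teichmüller lift,
`ε` the `p`-adic cyclotomic character) satisfies `Ψ⁺(Frob_{v₀}) = q_{v₀}` for EVERY such `v₀` — the
moving divisor `{Ψ(Frob_{v₀}) = q_{v₀}}` has a fixed point, and the reducible type-`𝒟'` deformations of
ratio `Ψ⁺`, `(χ_b ν̃ ε, e; 0, χ_b)` with `[e] ∈ ℙ(X_split)`, `X = H¹(G_{F,S'}, 𝒪(1)(ν̃))` (Kummer classes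
of `S'`-units of `F(ν)`), form a Steinberg-shaped reducible family of Krull dimension `t + 2`, where
`t` is the number of ALIGNED places below.  So "small reducible Steinberg locus" needs `t ≤ 1`; the
corrected heart stub carries `AtMostOneAlignedPlace` and the complement joins the regime stub.
Independently the engine/crossing audit found that `ModelData.Models` records no integrality/locality
of the specialisation `φ : R → ℚ̄_p` (abstract ring maps into `ℚ̄_p` can be wild), while the crossing
stub must push a pro-modular point of `R/ker φ` CONTINUOUSLY into `ℚ̄_p`; `ModelData.IsLocalPoint`
records exactly the two inequalities the datum stub's construction (`φ = (𝒪_E ↪ ℚ̄_p) ∘ φ_E`,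
`φ_E` a local `𝒪`-algebra map) provides. -/

section ReshapeV2

variable {F : Type} [Field F] [NumberField F] (p : ℕ) [Fact p.Prime]

/-- **An aligned place of `(ρ, ρ₀)`**: a finite place `v ∤ p` at which `ρ` is RAMIFIED and the residual
ratio is LOCALLY CYCLOTOMIC, `χ̄_a|_{D_v} = ω·χ̄_b|_{D_v}` — read on the integral model as
`v((ρ₀ σ)₀₀ − ε(σ)·(ρ₀ σ)₁₁) < 1` for all `σ ∈ Γ_{F_v}` (e.g. a multiplicative place `v` of an elliptic
curve with `N v ≡ 1 (mod p)` in the étale-kernel frame).  Each aligned place contributes an `S'`-unit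
Kummer class in the `(Ψ̄ω⁻¹)`-isotypic part which, at the fixed point `Ψ⁺ = Ψ̃·⟨ε⟩` of every Steinberg
hyperplane `{Ψ(Frob_{v₀}) = q_{v₀}}`, raises the split Selmer rank by one (stub-worker audit of the heart
stub, wave 1). [folklore] -/
def IsAlignedPlace {O : ValuationSubring (PadicAlgCl p)} (ρ : FramedGaloisRep F (PadicAlgCl p) 2)
    (ρ₀ : absoluteGaloisGroup F →* GL (Fin 2) O) (v : HeightOneSpectrum (𝓞 F)) : Prop :=
  (p : 𝓞 F) ∉ v.asIdeal ∧ ¬ ρ.IsUnramifiedAt v ∧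
    ∀ σ : absoluteGaloisGroup (v.adicCompletion F),
      Valued.v ((((ρ₀ (absGaloisRestrict F (v.adicCompletion F) σ)).val 0 0 : O) : PadicAlgCl p) -
        algebraMap ℚ_[p] (PadicAlgCl p)
          ((((GaloisRep.cyclotomicCharacter F p (absGaloisRestrict F (v.adicCompletion F) σ) :
            ℤ_[p]ˣ) : ℤ_[p]) : ℚ_[p])) *
        (((ρ₀ (absGaloisRestrict F (v.adicCompletion F) σ)).val 1 1 : O) : PadicAlgCl p)) < 1

/-- **At most one aligned place** (`t ≤ 1`): the regime in which the fixed point `Ψ⁺` of the Steinberg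
hyperplanes carries a reducible Steinberg-shaped family of Krull dimension `t + 2 ≤ 3` only — the
necessary extra hypothesis of the corrected heart stub (for `Ψ̄ = ω`, where the complex-place unit is
absent, `t ≤ 2` would suffice; not used). [folklore] -/
def AtMostOneAlignedPlace {O : ValuationSubring (PadicAlgCl p)}
    (ρ : FramedGaloisRep F (PadicAlgCl p) 2) (ρ₀ : absoluteGaloisGroup F →* GL (Fin 2) O) : Prop :=
  ∀ v₁ v₂ : HeightOneSpectrum (𝓞 F), IsAlignedPlace p ρ ρ₀ v₁ → IsAlignedPlace p ρ ρ₀ v₂ → v₁ = v₂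

/-- **The specialisation of a model is a LOCAL INTEGRAL point**: `φ : R_𝒟 → ℚ̄_p` takes values in the
valuation ring and takes the maximal ideal into the maximal ideal (`‖φ r‖ ≤ 1`, and `‖φ r‖ < 1` on
`𝔪_R`).  With `𝔪_R` finitely generated this makes `R/ker φ → ℚ̄_p` continuous for the `𝔪_R`-adic
topology (`‖φ(𝔪_Rⁿ)‖ ≤ cⁿ`, `c < 1`), the datum the crossing stub needs to turn a pro-modular prime
`ker φ` into `p`-adic automorphy of `ρ`; it holds for the datum stub's `φ = (𝒪_E ↪ ℚ̄_p) ∘ φ_E`. [folklore] -/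
def ModelData.IsLocalPoint (M : ModelData F p) : Prop :=
  (∀ r, Valued.v (M.φ r) ≤ 1) ∧ ∀ r ∈ IsLocalRing.maximalIdeal M.𝓡.R, Valued.v (M.φ r) < 1

end ReshapeV2

end

end Summit.Langlands.Langlands.Cruxes.ReducibleOrdinaryProModular.SteinbergHyperplane
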